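import Literature.AlgebraicTopology.SingularHomology.TwoPieceProductCohomology
import Literature.AlgebraicTopology.SingularHomology.RelativeCupRight
import HarnessLib

/-!
# The boundary-excision map `κ` of a two-piece cover is `H*(U × Y)`-linear

A. Hatcher, *Algebraic Topology* (2002), §3.1 pp. 200–201 (the decomposition of `H*(U × Y)` for
`Y = Y₁ ∪ Y₂` through `κ = j ∘ exc⁻¹ ∘ δ`, `TwoPieceProductCohomology`) with §3.2 p. 209 / Lemma 3.6
(cup products with global classes commute with restriction, excision and the connecting map;
D. Husemoller, *Fibre Bundles*, Ch. 17 §1, proof of the Leray–Hirsch theorem): for every class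
`a ∈ Hⁱ(U × (Y₁ ∩ Y₂))` and every GLOBAL class `y ∈ Hᵠ(U × Y)`,

  **`κ (a ⌣ y|) = κ a ⌣ y`** (`twoPieceKappa_cupProduct`),

from `δ_cupRight` (linearity of the connecting map of the pair `(U × Y₂, U × (Y₁ ∩ Y₂))`),
`map_cupRight` (excision is a map of pairs) and `toAbsolute_cupRight` (`RelativeCupRight`). This is
the input for the `H*(U)`-linearity of the splittings of `H*(U × C)` (`C` circle-like) and
`H*(U × P)` (`P` sphere-like) and hence for their cup-product form.

Everything is proved; no named facts.

## References

* A. Hatcher, *Algebraic Topology*, CUP 2002, §3.1 pp. 200–201, §3.2 p. 209, Lemma 3.6. [HatcherAT2002]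
* D. Husemoller, *Fibre Bundles*, GTM 20, Springer 1994, Ch. 17 §1 Thm. 1.1 (proof). [HusemollerFibreBundles1994]
-/

noncomputable section

open CategoryTheory Set

universe u

namespace Literature.AlgebraicTopology.SingularHomology

variable {U : Type u} {Y : Type u} [TopologicalSpace U] [TopologicalSpace Y]
variable (R : Type u) [CommRing R]
variable {Y₁ Y₂ : Set Y} (h₁ : IsOpen Y₁) (h₂ : IsOpen Y₂) (hcov : Y₁ ∪ Y₂ = univ)

/-- The inclusion `j : ↥(U × (Y₁ ∩ Y₂)) → U × Y` (through `↥(U × Y₂)`). [folklore] -/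
abbrev interIncl (U : Type u) [TopologicalSpace U] (Y₁ Y₂ : Set Y) : C(↥(inter U Y₁ Y₂), U × Y) :=
  (subsetIncl (vert U Y₂)).comp (subsetIncl (inter U Y₁ Y₂))

/-- **Excision commutes with the right cup product by a global class**:
`exc⁻¹ (r ⌣ y|_{U × Y₂}) = exc⁻¹ r ⌣ y`. [cite: HatcherAT2002, §3.2 p. 209] -/
theorem inv_excMap_cupRight {p q n : ℕ} (h : p + q = n) [IsIso (excMap R R (U := U) Y₁ Y₂ p)]
    [IsIso (excMap R R (U := U) Y₁ Y₂ n)]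
    (r : relSingularCohomology R R ↥(vert U Y₂) (inter U Y₁ Y₂) p) (y : singularCohomology R R (U × Y) q) :
    inv (excMap R R Y₁ Y₂ n)
        (relSingularCohomology.cupRight h r (singularCohomology.map R R (subsetIncl (vert U Y₂)) q y)) =
      relSingularCohomology.cupRight h (inv (excMap R R Y₁ Y₂ p) r) y := by
  apply ((ConcreteCategory.isIso_iff_bijective (excMap R R (U := U) Y₁ Y₂ n)).1 inferInstance).1
  rw [excMap_apply_inv_excMap]
  change _ = relSingularCohomology.map R R (subsetIncl (vert U Y₂)) (Set.mapsTo_preimage Subtype.val (vert U Y₁)) n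
    (relSingularCohomology.cupRight h _ y)
  rw [relSingularCohomology.map_cupRight]
  congr 1
  exact (excMap_apply_inv_excMap R R p r).symm

/-- **`κ` is `H*(U × Y)`-linear: `κ (a ⌣ j^*y) = κ a ⌣ y`** for the boundary-excision map
`κ : Hⁱ(U × (Y₁ ∩ Y₂)) → Hⁱ⁺¹(U × Y)` of an open cover `Y = Y₁ ∪ Y₂` and a global class `y ∈ Hᵠ(U × Y)`.
[cite: HusemollerFibreBundles1994, Ch. 17 §1 Thm. 1.1 (proof)] -/
theorem twoPieceKappa_cupProduct {i q n : ℕ} (h : i + q = n) (a : singularCohomology R R ↥(inter U Y₁ Y₂) i)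
    (y : singularCohomology R R (U × Y) q) :
    twoPieceKappa R R h₁ h₂ hcov n (cupProduct h a (singularCohomology.map R R (interIncl U Y₁ Y₂) q y)) =
      cupProduct (show (i + 1) + q = n + 1 by omega) (twoPieceKappa R R h₁ h₂ hcov i a) y := by
  haveI := isIso_excMap R R (U := U) h₁ h₂ hcov (i + 1)
  haveI := isIso_excMap R R (U := U) h₁ h₂ hcov (n + 1)
  rw [twoPieceKappa_apply, twoPieceKappa_apply, ← relSingularCohomology.toAbsolute_cupRight,
    ← inv_excMap_cupRight R (show (i + 1) + q = n + 1 by omega)]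
  congr 2
  rw [singularCohomology.map_comp, ModuleCat.comp_apply]
  subst h
  exact relSingularCohomology.δ_cupRight rfl a _

end Literature.AlgebraicTopology.SingularHomology
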